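import Literature.Combinatorics.Sahi2008.FKGCumulation
import Literature.Combinatorics.Sahi2008.PushForward
import Summits.CriticalPhenomena.PercolationContinuityZ3.Theorems.PercNearOneGluingNoHeavyLowerTailSahiC3CubeThreeFKG

/-!
# `NoHeavyLowerTail` (crux stmt-CriticalPhenomena-4575), Sahi programme P1: Sahi's Conjecture 5 on `2^X`, `|X| = 3`,
# for EVERY FKG measure and EVERY order `n` — and the finite antichain basis of Sahi positivity on a fixed lattice

Support file (Sahi cell, seat `prim-sahi-p1`, generation 2; `--supports stmt-CriticalPhenomena-4575`).

Sahi [Combinatorica 28 (2008), Prop. 15] proves his Conjecture 5 (`E_n(f_1,…,f_n) ≥ 0` for nonnegative increasing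
`f_i` under an FKG weight) on `2^X` for `|X| ≤ 2` and every `n` (tree: `SahiTwoPointLatticeTheorem_holds`); generation 1 of
this seat proved the case `|X| = 3, n = 3` (`SahiC3Cube.latticeE3_nonneg_cube_three`).  This file proves the case
**`|X| = 3`, every `n`** (`sahiPositive_cube_three`), new mathematics not in print, by a reduction valid on every finite
distributive lattice:

* **Peel step for a nested pair** (`sahiE_setInd_nonneg_of_nested`).  By the Lieb–Sahi recursion
  `E_{m+2}(h, g) = Σ_i E_{m+1}(g_0,…,g_i h,…,g_m) − E_{m+1}(g)·E(h)` [LiebSahi2021, Prop. 3.3] with `h = χ_{U_i}` and a slot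
  `χ_{U_j}`, `U_j ⊆ U_i`, absorbed by it (`sahiE_cons_nonneg_of_absorbed`, the mechanism of the tree's proof of Prop. 15):
  if every `(m+1)`-family of up-sets has `E_{m+1} ≥ 0`, then every `(m+2)`-family WITH A NESTED PAIR has `E_{m+2} ≥ 0`.
* **Antichain basis** (`sahiPositive_of_antichainBasis`).  Hence, for an FKG weight `μ` on a finite distributive lattice
  `L`, `SahiPositive μ n` for EVERY `n` follows from `E_k ≥ 0` for the finitely many ANTICHAIN families (pairwise non-nested
  up-sets) of sizes `3 ≤ k ≤ width(Up L)`; order `2` is the FKG inequality.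
* **The cube `{0,1}³`.**  Its `20` up-sets split into the `4` chains
  `∅ ⊂ abc ⊂ ab ⊂ a(b∨c) ⊂ a ⊂ a∨bc ⊂ a∨b ⊂ a∨b∨c ⊂ 1`, `ac ⊂ c(a∨b) ⊂ c ⊂ c∨ab ⊂ a∨c`, `bc ⊂ b(a∨c) ⊂ b ⊂ b∨ac ⊂ b∨c`,
  `{maj}` (`chain3_nested`, checked pairwise by `decide`), so every family of `≥ 5` up-sets has a nested pair, and the only
  antichain of size `4` is `{a, b, c, maj}` (three principal up-sets: `E_4 ≥ 0` by cumulation padding,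
  `sahiE_nonneg_of_isLatticeCumulation_offTwo`); antichain triples are covered by `latticeE3_nonneg_cube_three`.

Scope remark (why `|X| = 4` is different): the up-sets of `{0,1}⁴` have width `≥ 20` and more than `5·10⁷` antichain
families (seat enumeration), so the basis is no longer a handful of named cases.
-/

namespace Summit.CriticalPhenomena.PercolationContinuityZ3.Theorems.SahiCubeAllOrders

open Finset Function Literature.Combinatorics.Sahi2008 Literature.Probability.LatticeModels
open scoped BigOperators

/-! ## Part 1.  Any finite distributive lattice: the nested-pair peel and the antichain basis -/

section General

variable {α : Type*} [Fintype α] [DecidableEq α]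

/-- `E_1(χ_U) = μ(U) ≥ 0` for a nonnegative weight. [folklore] -/
theorem sahiE_one_setInd_nonneg {μ : α → ℝ} (hμ : ∀ x, 0 ≤ μ x) (U : Fin 1 → Finset α) :
    0 ≤ sahiE μ 1 (fun i => setInd (U i)) := by
  rw [sahiE_one_apply]
  exact ex_nonneg hμ fun x => setInd_nonneg _ _

omit [Fintype α] in
/-- Replacing one set of a family by its intersection with `W` multiplies the corresponding indicator slot by `χ_W`. [folklore] -/
theorem setInd_family_update_inter {m : ℕ} (V : Fin m → Finset α) (k : Fin m) (W : Finset α) :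
    (fun k' => setInd (update V k (V k ∩ W) k')) = update (fun k' => setInd (V k')) k (setInd (V k) * setInd W) := by
  funext k'
  by_cases hk : k' = k
  · subst hk
    simp only [update_self, setInd_mul]
  · simp only [update_of_ne hk]

/-- **Peel step for a nested pair.**  For a probability weight `μ ≥ 0` on a preorder: if `E_{m+1} ≥ 0` for every
`(m+1)`-family of up-sets, then `E_{m+2}(χ_{U_0},…,χ_{U_{m+1}}) ≥ 0` for every `(m+2)`-family of up-sets with a nested pair
`U_j ⊆ U_i`, `i ≠ j` (put `χ_{U_i}` at the head by symmetry; the slot `χ_{U_j}` is absorbed; every modified tail is again a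
family of up-sets). [this work; mechanism: LiebSahi2021 Prop. 3.3 via `sahiE_cons_nonneg_of_absorbed`] -/
theorem sahiE_setInd_nonneg_of_nested [Preorder α] {μ : α → ℝ} (hμ0 : ∀ x, 0 ≤ μ x) (hμ1 : ∑ x, μ x = 1) {m : ℕ}
    (ih : ∀ V : Fin (m + 1) → Finset α, (∀ k, IsUpperSet ((V k : Finset α) : Set α)) →
      0 ≤ sahiE μ (m + 1) (fun k => setInd (V k)))
    (U : Fin (m + 2) → Finset α) (hU : ∀ k, IsUpperSet ((U k : Finset α) : Set α))
    {i j : Fin (m + 2)} (hij : i ≠ j) (hsub : U j ⊆ U i) :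
    0 ≤ sahiE μ (m + 2) (fun k => setInd (U k)) := by
  obtain ⟨σ, hσ⟩ : ∃ σ : Equiv.Perm (Fin (m + 2)), σ = Equiv.swap 0 i := ⟨_, rfl⟩
  have hσ0 : σ 0 = i := by rw [hσ, Equiv.swap_apply_left]
  have hfam : (fun k => setInd (U (σ k))) =
      Matrix.vecCons (setInd (U i)) (fun k => setInd (U (σ k.succ))) := by
    funext k
    refine Fin.cases ?_ (fun k' => ?_) k
    · simp only [Matrix.cons_val_zero, hσ0]
    · simp only [Matrix.cons_val_succ]
  rw [← sahiE_comp_perm μ (m + 2) σ (fun k => setInd (U k)), hfam]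
  refine sahiE_cons_nonneg_of_absorbed ?_ ?_ ?_ ?_
  · calc ex μ (setInd (U i)) ≤ ex μ (fun _ => (1 : ℝ)) :=
          ex_mono hμ0 fun x => by
            rw [setInd_apply]
            split_ifs <;> norm_num
      _ = 1 := ex_const hμ1 1
  · have hj0 : σ.symm j ≠ 0 := by
      intro h0
      apply hij
      rw [← hσ0, ← h0, Equiv.apply_symm_apply]
    obtain ⟨k₀, hk₀⟩ := Fin.exists_succ_eq.2 hj0
    refine ⟨k₀, ?_⟩
    have hσk : σ k₀.succ = j := by rw [hk₀, Equiv.apply_symm_apply]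
    show setInd (U (σ k₀.succ)) * setInd (U i) = setInd (U (σ k₀.succ))
    rw [hσk, setInd_mul, Finset.inter_eq_left.2 hsub]
  · exact ih (fun k => U (σ k.succ)) fun k => hU _
  · intro k
    show 0 ≤ sahiE μ (m + 1)
      (update (fun k' => setInd (U (σ k'.succ))) k (setInd (U (σ k.succ)) * setInd (U i)))
    rw [← setInd_family_update_inter (fun k' => U (σ k'.succ)) k (U i)]
    refine ih _ fun k' => ?_
    by_cases hk : k' = k
    · subst hk
      rw [update_self, Finset.coe_inter]
      exact (hU _).inter (hU _)
    · rw [update_of_ne hk]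
      exact hU _

/-- **Antichain basis, indicator form.**  For an FKG weight on a finite distributive lattice: if every antichain family
(pairwise non-nested, `Pairwise fun i j => ¬ U j ⊆ U i`) of `k ≥ 3` up-sets has `E_k ≥ 0`, then EVERY family of up-sets
has `E_k ≥ 0` (induction on `k`: order `1` is trivial,
order `2` is the FKG inequality, a nested pair is peeled by `sahiE_setInd_nonneg_of_nested`). [this work] -/
theorem sahiE_setInd_nonneg_of_antichainBasis [DistribLattice α] {μ : α → ℝ} (hμ : IsFKGMeasure μ)
    (H : ∀ (k : ℕ) (U : Fin (k + 3) → Finset α), (∀ i, IsUpperSet ((U i : Finset α) : Set α)) →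
      (Pairwise fun i j => ¬ U j ⊆ U i) → 0 ≤ sahiE μ (k + 3) (fun i => setInd (U i))) :
    ∀ (k : ℕ) (U : Fin (k + 1) → Finset α), (∀ i, IsUpperSet ((U i : Finset α) : Set α)) →
      0 ≤ sahiE μ (k + 1) (fun i => setInd (U i)) := by
  intro k
  induction k with
  | zero =>
    intro U _
    exact sahiE_one_setInd_nonneg hμ.nonneg U
  | succ k ih =>
    intro U hU
    by_cases hanti : Pairwise fun i j => ¬ U j ⊆ U i
    · cases k with
      | zero =>
        exact sahiPositive_two hμ _ (fun i x => setInd_nonneg _ _) (fun i => monotone_setInd (hU i))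
      | succ k => exact H k U hU hanti
    · unfold Pairwise at hanti
      push Not at hanti
      obtain ⟨i, j, hij, hsub⟩ := hanti
      exact sahiE_setInd_nonneg_of_nested hμ.nonneg hμ.sum_eq_one ih U hU hij hsub

/-- **Antichain basis of Sahi positivity.**  For an FKG weight `μ` on a finite distributive lattice `L`: if
`E_k(χ_{U_1},…,χ_{U_k}) ≥ 0` for every antichain family of `k ≥ 3` up-sets (there are finitely many: `k ≤ width(Up L)`),
then `μ` is Sahi-positive of EVERY order `n` (layer cake `sahiPositive_iff_indicators` + the indicator form). [this work] -/
theorem sahiPositive_of_antichainBasis [DistribLattice α] {μ : α → ℝ} (hμ : IsFKGMeasure μ)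
    (H : ∀ (k : ℕ) (U : Fin (k + 3) → Finset α), (∀ i, IsUpperSet ((U i : Finset α) : Set α)) →
      (Pairwise fun i j => ¬ U j ⊆ U i) → 0 ≤ sahiE μ (k + 3) (fun i => setInd (U i)))
    (n : ℕ) : SahiPositive μ n := by
  match n with
  | 0 => exact sahiPositive_zero μ
  | k + 1 =>
    rw [sahiPositive_iff_indicators]
    exact sahiE_setInd_nonneg_of_antichainBasis hμ H k

end General

/-! ## Part 2.  The cube `{0,1}³`: four chains of up-sets, the unique antichain of size `4`, and all orders -/

section CubeThree

open SahiC3Cube OneCutCert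

/- CHAIN INDEX.  The `20` up-sets of `{0,1}³` (codes `encF 3`, point codes `0 = ∅, 1 = a, 2 = b, 3 = ab, 4 = c, 5 = ac,
6 = bc, 7 = abc`) split into the four chains `∅ ⊂ abc ⊂ ab ⊂ a(b∨c) ⊂ a ⊂ a∨bc ⊂ a∨b ⊂ a∨b∨c ⊂ 1` (index `0`: all other
codes), `ac ⊂ c(a∨b) ⊂ c ⊂ c∨ab ⊂ a∨c` (index `1`: codes `160, 224, 240, 248, 250`), `bc ⊂ b(a∨c) ⊂ b ⊂ b∨ac ⊂ b∨c`
(index `2`: codes `192, 200, 204, 236, 252`) and `{maj}` (index `3`: code `232`).  The index is written inline as the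
lambda `chainIx` below (no auxiliary definition). -/

/-- Two up-sets of `{0,1}³` in the same chain are nested (kernel check over the `20` increasing codes). [this work] -/
theorem chain3_nested : ∀ x ∈ upsN 3, ∀ y ∈ upsN 3,
    (fun x : ℕ => (if x ∈ [160, 224, 240, 248, 250] then (1 : Fin 4) else if x ∈ [192, 200, 204, 236, 252] then 2
      else if x = 232 then 3 else 0)) x =
    (fun x : ℕ => (if x ∈ [160, 224, 240, 248, 250] then (1 : Fin 4) else if x ∈ [192, 200, 204, 236, 252] then 2
      else if x = 232 then 3 else 0)) y →
    (x &&& y = x ∨ y &&& x = y) := by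
  decide

/-- An up-set of `{0,1}³` not nested with `maj = ab∨ac∨bc` (code `232`) is one of the principal up-sets `a, b, c`
(codes `coneN3 1 = 170`, `coneN3 2 = 204`, `coneN3 4 = 240`). [this work] -/
theorem principal_of_not_nested_maj :
    ∀ x ∈ upsN 3, ¬ (x &&& 232 = x ∨ 232 &&& x = 232) → (x = coneN3 1 ∨ x = coneN3 2 ∨ x = coneN3 4) := by
  decide

/-- The only code in chain `3` is `maj`. [this work] -/
theorem eq_maj_of_chain3 : ∀ x ∈ upsN 3,
    (fun x : ℕ => (if x ∈ [160, 224, 240, 248, 250] then (1 : Fin 4) else if x ∈ [192, 200, 204, 236, 252] then 2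
      else if x = 232 then 3 else 0)) x = 3 → x = 232 := by
  decide

variable {μ : (Fin 3 → Bool) → ℝ}

/-- Nested codes, in either order, give a nested pair of the family (plumbing). [this work] -/
theorem nested_of_codes {n : ℕ} (U : Fin n → Finset (Fin 3 → Bool)) {i j : Fin n}
    (h : encF 3 (U i) &&& encF 3 (U j) = encF 3 (U i) ∨ encF 3 (U j) &&& encF 3 (U i) = encF 3 (U j)) :
    U i ⊆ U j ∨ U j ⊆ U i := by
  rcases h with h | h
  · exact Or.inl (subset_of_encF h)
  · exact Or.inr (subset_of_encF h)

/-- **Five up-sets of `{0,1}³` always contain a nested pair** (pigeonhole over the four chains): no antichain family of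
size `≥ 5`. [this work] -/
theorem not_pairwise_not_subset_of_five_le {n : ℕ} (hn : 5 ≤ n) (U : Fin n → Finset (Fin 3 → Bool))
    (hU : ∀ i, IsUpperSet ((U i : Finset (Fin 3 → Bool)) : Set (Fin 3 → Bool))) :
    ¬ Pairwise fun i j => ¬ U j ⊆ U i := by
  intro hanti
  set ch : ℕ → Fin 4 := (fun x : ℕ => (if x ∈ [160, 224, 240, 248, 250] then (1 : Fin 4) else if x ∈ [192, 200, 204, 236, 252] then 2
      else if x = 232 then 3 else 0)) with hch
  have hcard : Fintype.card (Fin 4) < Fintype.card (Fin n) := by simp only [Fintype.card_fin]; omega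
  obtain ⟨i, j, hij, hc⟩ := Fintype.exists_ne_map_eq_of_card_lt (fun i => ch (encF 3 (U i))) hcard
  have hn := chain3_nested _ (encF_mem_upsN (hU i)) _ (encF_mem_upsN (hU j)) hc
  rcases nested_of_codes U hn with h | h
  · exact hanti (Ne.symm hij) h
  · exact hanti hij h

/-- **The antichain quadruple of `{0,1}³`.**  In an antichain family of four up-sets of the cube one member is `maj` and
the other three are principal up-sets, so `E_4 ≥ 0` by cumulation padding (at most two non-cumulation slots,
`sahiE_nonneg_of_isLatticeCumulation_offTwo`). [this work] -/
theorem sahiE_four_nonneg_of_pairwise_not_subset (hμ : IsFKGMeasure μ) (U : Fin 4 → Finset (Fin 3 → Bool))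
    (hU : ∀ i, IsUpperSet ((U i : Finset (Fin 3 → Bool)) : Set (Fin 3 → Bool)))
    (hanti : Pairwise fun i j => ¬ U j ⊆ U i) : 0 ≤ sahiE μ 4 (fun i => setInd (U i)) := by
  -- some member is `maj`: otherwise the four codes lie in the chains `0, 1, 2`
  set ch : ℕ → Fin 4 := (fun x : ℕ => (if x ∈ [160, 224, 240, 248, 250] then (1 : Fin 4) else if x ∈ [192, 200, 204, 236, 252] then 2
      else if x = 232 then 3 else 0)) with hch
  have hmaj : ∃ i₀, encF 3 (U i₀) = 232 := by
    by_contra hno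
    push Not at hno
    have hlt : ∀ i, ((ch (encF 3 (U i)) : Fin 4) : ℕ) < 3 := by
      intro i
      have hne : ch (encF 3 (U i)) ≠ 3 := fun h3 =>
        hno i (eq_maj_of_chain3 _ (encF_mem_upsN (hU i)) h3)
      have hle : ((ch (encF 3 (U i)) : Fin 4) : ℕ) < 4 := Fin.is_lt _
      have hne' : ((ch (encF 3 (U i)) : Fin 4) : ℕ) ≠ 3 := fun h => hne (Fin.ext h)
      omega
    have hcard : Fintype.card (Fin 3) < Fintype.card (Fin 4) := by simp
    obtain ⟨i, j, hij, hc⟩ := Fintype.exists_ne_map_eq_of_card_lt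
      (fun i => (⟨((ch (encF 3 (U i)) : Fin 4) : ℕ), hlt i⟩ : Fin 3)) hcard
    have hc' : ch (encF 3 (U i)) = ch (encF 3 (U j)) := Fin.ext (by simpa using congrArg Fin.val hc)
    have hn := chain3_nested _ (encF_mem_upsN (hU i)) _ (encF_mem_upsN (hU j)) hc'
    rcases nested_of_codes U hn with h | h
    · exact hanti (Ne.symm hij) h
    · exact hanti hij h
  obtain ⟨i₀, hi₀⟩ := hmaj
  -- every other member is a principal up-set
  have hprin : ∀ i, i ≠ i₀ → IsLatticeCumulation (setInd (U i)) := by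
    intro i hi
    have hnn : ¬ (encF 3 (U i) &&& 232 = encF 3 (U i) ∨ 232 &&& encF 3 (U i) = 232) := by
      rw [← hi₀]
      intro h
      rcases nested_of_codes U h with h' | h'
      · exact hanti (Ne.symm hi) h'
      · exact hanti hi h'
    rcases principal_of_not_nested_maj _ (encF_mem_upsN (hU i)) hnn with hp | hp | hp
    · rw [eq_principalUp_of_encF (by norm_num) hp]; exact isLatticeCumulation_setInd_principalUp _
    · rw [eq_principalUp_of_encF (by norm_num) hp]; exact isLatticeCumulation_setInd_principalUp _
    · rw [eq_principalUp_of_encF (by norm_num) hp]; exact isLatticeCumulation_setInd_principalUp _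
  refine sahiE_nonneg_of_isLatticeCumulation_offTwo hμ _ (fun i x => setInd_nonneg _ _)
    (fun i => monotone_setInd (hU i)) {i₀} (by simp) fun i hi => hprin i ?_
  simpa using hi

/-- Antichain triples: generation 1's theorem `C₃` on `{0,1}³` for every FKG weight, in the `sahiE` vocabulary. [this work] -/
theorem sahiE_three_setInd_nonneg (hμ : IsFKGMeasure μ) (U : Fin 3 → Finset (Fin 3 → Bool))
    (hU : ∀ i, IsUpperSet ((U i : Finset (Fin 3 → Bool)) : Set (Fin 3 → Bool))) :
    0 ≤ sahiE μ 3 (fun i => setInd (U i)) := by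
  have hfam : (fun i => setInd (U i)) = ![setInd (U 0), setInd (U 1), setInd (U 2)] := by
    funext i
    fin_cases i <;> rfl
  rw [hfam, sahiE_three_indicator_eq_latticeE3 hμ.sum_eq_one]
  exact latticeE3_nonneg_cube_three (fun x => hμ.nonneg x) hμ.mul_le_mul (hU 0) (hU 1) (hU 2)

/-- **Sahi's Conjecture 5 on `{0,1}³`, every FKG measure, every order.**  For every FKG probability weight `μ` on the
cube `Fin 3 → Bool` and every `n`, `E_n(f_1,…,f_n) ≥ 0` for all nonnegative monotone `f_i` — the case `|X| = 3` of
[Sahi2008, Conj. 5], beyond the printed `|X| ≤ 2` (Prop. 15). [this work] -/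
theorem sahiPositive_cube_three (hμ : IsFKGMeasure μ) (n : ℕ) : SahiPositive μ n := by
  refine sahiPositive_of_antichainBasis hμ (fun k U hU hanti => ?_) n
  match k with
  | 0 => exact sahiE_three_setInd_nonneg hμ U hU
  | 1 => exact sahiE_four_nonneg_of_pairwise_not_subset hμ U hU hanti
  | k + 2 => exact absurd hanti (not_pairwise_not_subset_of_five_le (by omega) U hU)

end CubeThree

/-! ## Part 3.  Sahi's own setting: the power set `2^X` with `|X| ≤ 3` -/

section Transfer

variable {β γ : Type*} [Fintype β] [Fintype γ]

/-- **Sahi positivity descends along a monotone retraction.**  If `R : γ → β` is monotone and `R ∘ E = id`, then Sahi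
positivity of order `n` of the push-forward weight `E_* w` on `γ` gives Sahi positivity of order `n` of `w` on `β`
(test `f` on `β` with `f ∘ R` on `γ`: `E_n^{E_* w}(f ∘ R) = E_n^{w}(f ∘ R ∘ E) = E_n^{w}(f)`). [this work] -/
theorem sahiPositive_of_pushWeight_of_retract [Preorder β] [Preorder γ] {w : β → ℝ} {n : ℕ} {E : β → γ}
    {R : γ → β} (hR : Monotone R) (hRE : ∀ b, R (E b) = b) (h : SahiPositive (pushWeight w E) n) :
    SahiPositive w n := by
  intro f hf hmono
  have key := h (fun i => f i ∘ R) (fun i x => hf i (R x)) (fun i => (hmono i).comp hR)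
  rw [sahiE_pushWeight] at key
  have hfe : (fun i => (f i ∘ R) ∘ E) = f := by
    funext i b
    simp only [Function.comp_apply, hRE]
  rwa [hfe] at key

end Transfer

section PowerSet

variable {X : Type*} [Fintype X]

/-- **A lattice embedding `2^X ↪ {0,1}³` with a monotone retraction**, for `|X| ≤ 3`: given an injection
`ι : X ↪ Fin 3`, `E S = (t ↦ [ι⁻¹(t) ∈ S])` is injective and preserves `⊓`, `⊔`, and `R y = {x | y (ι x)}` is a monotone
left inverse (packaged existentially: no new definitions). [this work] -/
theorem exists_cube_embedding (ι : X ↪ Fin 3) :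
    ∃ (E : Set X → (Fin 3 → Bool)) (R : (Fin 3 → Bool) → Set X), Function.Injective E ∧
      (∀ S T, E (S ⊓ T) = E S ⊓ E T) ∧ (∀ S T, E (S ⊔ T) = E S ⊔ E T) ∧ Monotone R ∧ ∀ S, R (E S) = S := by
  classical
  obtain ⟨E, hE⟩ : ∃ E : Set X → (Fin 3 → Bool), ∀ S t, E S t = true ↔ ∃ x, ι x = t ∧ x ∈ S :=
    ⟨fun S t => decide (∃ x, ι x = t ∧ x ∈ S), fun S t => by simp only [decide_eq_true_eq]⟩
  obtain ⟨R, hR⟩ : ∃ R : (Fin 3 → Bool) → Set X, ∀ y x, x ∈ R y ↔ y (ι x) = true :=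
    ⟨fun y => {x | y (ι x) = true}, fun y x => Iff.rfl⟩
  -- the coordinate `ι x` of `E S` is membership of `x`
  have hEι : ∀ S x, E S (ι x) = true ↔ x ∈ S := by
    intro S x
    rw [hE]
    constructor
    · rintro ⟨x', hx', hS⟩
      rwa [← ι.injective hx']
    · intro hx
      exact ⟨x, rfl, hx⟩
  have hRE : ∀ S, R (E S) = S := by
    intro S
    ext x
    rw [hR, hEι]
  refine ⟨E, R, fun S T h => by rw [← hRE S, h, hRE], fun S T => ?_, fun S T => ?_, fun y z hyz x hx => ?_, hRE⟩
  · funext t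
    show E (S ∩ T) t = (E S t && E T t)
    rw [Bool.eq_iff_iff, hE, Bool.and_eq_true, hE, hE]
    constructor
    · rintro ⟨x, hx, hS, hT⟩
      exact ⟨⟨x, hx, hS⟩, ⟨x, hx, hT⟩⟩
    · rintro ⟨⟨x, hx, hS⟩, ⟨x', hx', hT⟩⟩
      have hxx : x' = x := ι.injective (hx'.trans hx.symm)
      subst hxx
      exact ⟨x', hx, hS, hT⟩
  · funext t
    show E (S ∪ T) t = (E S t || E T t)
    rw [Bool.eq_iff_iff, hE, Bool.or_eq_true, hE, hE]
    constructor
    · rintro ⟨x, hx, hS | hT⟩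
      · exact Or.inl ⟨x, hx, hS⟩
      · exact Or.inr ⟨x, hx, hT⟩
    · rintro (⟨x, hx, hS⟩ | ⟨x, hx, hT⟩)
      · exact ⟨x, hx, Or.inl hS⟩
      · exact ⟨x, hx, Or.inr hT⟩
  · rw [hR] at hx ⊢
    have h1 : y (ι x) ≤ z (ι x) := hyz (ι x)
    rw [hx] at h1
    exact top_le_iff.1 h1

/-- **Sahi's Conjecture 5 for `|X| ≤ 3`** (Sahi proved `|X| ≤ 2`, [Sahi2008, Prop. 15]; tree
`SahiTwoPointLatticeTheorem_holds`).  On the power set `2^X` of a type with at most three elements, every FKG probability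
weight is Sahi-positive of EVERY order: `E_n(f_1,…,f_n) ≥ 0` for all `n` and all nonnegative increasing `f_i`.  Proof: push
the weight forward along a lattice embedding `2^X ↪ {0,1}³` (it stays FKG, `isFKGMeasure_pushWeight`), apply
`sahiPositive_cube_three`, and descend along the monotone retraction (`sahiPositive_of_pushWeight_of_retract`). [this work] -/
theorem sahiPositive_set_of_card_le_three (hX : Fintype.card X ≤ 3) {μ : Set X → ℝ} (hμ : IsFKGMeasure μ) (n : ℕ) :
    SahiPositive μ n := by
  have hι : Nonempty (X ↪ Fin 3) := by
    rw [Function.Embedding.nonempty_iff_card_le, Fintype.card_fin]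
    exact hX
  obtain ⟨ι⟩ := hι
  obtain ⟨E, R, hEinj, hEinf, hEsup, hRmono, hRE⟩ := exists_cube_embedding ι
  have hμ' : IsFKGMeasure (pushWeight μ E) := isFKGMeasure_pushWeight hμ hEinj hEinf hEsup
  exact sahiPositive_of_pushWeight_of_retract hRmono hRE (sahiPositive_cube_three hμ' n)

/-- The same statement in the shape of the tree's named fact for `|X| ≤ 2` (`SahiTwoPointLatticeTheorem`), now for
`|X| ≤ 3`: for every type `X` with at most three elements, every FKG probability weight on `Set X` and every `n`,
`SahiPositive μ n`. [this work] -/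
theorem sahiThreePointLattice :
    ∀ (X : Type) [Fintype X], Fintype.card X ≤ 3 → ∀ μ : Set X → ℝ, IsFKGMeasure μ → ∀ n : ℕ, SahiPositive μ n := by
  intro X _ hX μ hμ n
  exact sahiPositive_set_of_card_le_three hX hμ n

end PowerSet

end Summit.CriticalPhenomena.PercolationContinuityZ3.Theorems.SahiCubeAllOrders
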